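import Summits.HodgeConjecture.CorCM.HypLiu418.A3Liu418GSSeesawSource
import Summits.HodgeConjecture.HodgeConjecture.Theorems.A3Liu418S34ClauseOneTarget
import Summits.HodgeConjecture.CorCM.LevelConjugate
import Literature.AlgebraicGeometry.ShimuraVarieties.UnitaryShimuraCurveCanonicalModelExists
import Literature.AlgebraicGeometry.ShimuraVarieties.UnitaryShimuraCurveSourceClauses
import Literature.AlgebraicGeometry.Morphisms.ComplexBettiPullbackSquare
import Literature.NumberTheory.Automorphic.UnitaryGroupFrameSubform
import Literature.NumberTheory.Automorphic.UnitaryGroupFrameEmbeddingLevels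
import HarnessLib

/-!
# Line `a3_liu418`, residual `stub_S34`: CLAUSE (1) of `S34SomeSource` FROM THE GS SEESAW SOURCE, at the explicit carrier `(C₄, T₄)`

Cell `hodgecm-mathlib` (D-0151), fan A, crux `HLiu418` (stmt-HodgeConjecture-24832), GS programme node (7-main) = F6 of KEY `gs7-clause1-lead`
(author A-p18 g7; text 6f07f2ed418e81fc, kernel-green by paste 2026-08-29T00:45Z and by import over ★ GS-4 / ★ (b)).  THEOREMS ONLY: no definition,
no instance, no named fact, no `sorry`.  HC_CM is NOT proved by this file (proved only modulo the 7 printed citations); the named facts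
`exists_recordSystemGS` (GS-3: canonical model of the compact unitary Shimura CURVE with its translates / embedding / level quotients,
[Deligne1979ShimuraVarieties] 2.7.20–2.7.21, [Milne2005ShimuraVarieties] 13.6–13.8), `MR92Prop6Source` (III-8′), `heckeTranslate_definedOver` and
`exists_recordSystem` enter as HYPOTHESES `hGS3`, `hMR`, `hU7`, `h`.

[Liu2021] proof of Thm. 4.15, p. 51 l. 2199–2213 with fn. 9: «for every class `c ∈ H¹_{(2)}(Sh(G,h), ℂ)` … one can find a decomposition
`V = V⋆ ⊕ V⋆^⊥` as above with `dim V⋆ = 2` such that the image of `c` under the restriction map … in `H¹_B(Sh(G⋆,h⋆), ℂ)` is nonzero».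
Here, at `V`'s own §4.2 datum `C₄ := Model.sec42DataOfFourLe h V Φ h4 iso` with translates `T₄ := sec42DataOfFourLe_heckeTranslates hU7 h V Φ h4 iso`,
for an étale Hecke datum `X` induced by `T₄`, a Betti pinning along `conj ∘ ι₁` and a NON-ZERO `f` of the `ℚ_ℓ^{ac}[𝔾]`-Hom-space, the SEESAW SOURCE
★ `seesawSourceGS …` (`CorCM/HypLiu418/A3Liu418GSSeesawSource.lean`; `M := towerHomGS`, the curve tower ★ `sec42DataGS` of GS-4
`A3Liu418GSInstance.lean` along ★ `φGS`) DETECTS `f`: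

* §0 `gsFace_*` — the antecedents of GS-3 at a `2 + 1` frame `(J⋆, J⊥, B)` of `V.Hm` (signature-`(1,1)` frame, definiteness off `ι₁`, anisotropy from
  `4 ≤ [F:ℚ]`, threshold `hK₀`, neatness), by name over ★ `UnitaryGroupFrameSubform` / ★ `UnitaryGroupFrameEmbeddingLevels`, and the cluster
  `gsFace_cluster (hGS3) (h) : ∃ S, hU7ₛ ∧ hLQ ∧ hEmb`;
* §1 `baseChange_recordEmbedding_comp_bridge_hom` — the source bridge square for `towerHomGS_map` (★ `baseChangeHomObjIsoOfComp_comm`);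
* §2a `schemeBettiPullAlong_towerHomGS_map_ne_zero` — at a record-typed level `Λ`: identity-piece data + `hdet` + `hc₁` ⇒
  `schemeBettiPullAlong (conj ∘ ι₁) ((towerHomGS S …).map Λ) x ≠ 0` (★ `RecordSystemGS.pieces`, ★ `exists_rep_inv_mul_rational_mem`,
  ★ `exists_fac_pullback_ne_zero_of_rational_reps`, ★ `complexBetti_map_ne_zero_of_square`);
* §2 HEAD **`exists_seesawSourceGS_etPull_comp_ne_zero`** — `∃ Jstar Jperp B hB hpos K₀ S hU7ₛ hEmb hLQ hK₀,
  (((seesawSourceGS S … Pin hK₀ (mkPin …)).M.toEtaleTowerHom.etPull ℓ).baseChange ℚ_ℓ^{ac}).comp f ≠ 0`, `Pin` generic with its feeder `mkPin`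
  (the registry's `FacePinData` constructor shape, D-ii′); proof = ★ F3 `Model.exists_identityPiece_detectingFrame_of_omegaHom_ne_zero` (target side,
  `Theorems/A3Liu418S34ClauseOneTarget.lean`) → frame `B := γ₁⁻¹ B₀` (★ `formCongr_mul_of_mem_rational`) → §0 → §2a → F3 (ii) with ★ `hI_GS` and
  ★ `sec42Data_injective_albaneseH1Cmp_of_n_eq_two`.

Consumer: the GS-8 closer `Theorems/A3Liu418S34OfGS.lean` (`s34SomeSource_CV_of_GS`: clause (1) = this head, clause (2) = GS-6 `frobeniusActsByGS`
through ★ `frobeniusActsBy_seesawSourceGS_iff`, transport to `(CV, TV)` by ★ `S34SomeSource.forall_transport`), then registry v18 `stub_S34`.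

References: [Liu2021] Y. Liu, arXiv:2102.11518 = Camb. J. Math. 9 (2021): Thm. 4.15 proof p. 51 (FJcycle.tex l. 2185–2213) with fn. 9, §4.2
(l. 2053–2081), §C.1 (l. 4597–4599); [MurtyRamakrishnan1992] Prop. 6 and Lemma B (through Liu2021 fn. 9); [Milne2005ShimuraVarieties] Lemma 5.13
p. 57, Thm. 13.6 p. 118; [Deligne1979ShimuraVarieties] Thm. 2.7.20, Cor. 2.7.21, 2.1.2–2.1.4, 2.2.5–2.2.6; [GortzWedhorn2020] Prop. 4.16;
[Kudla1984] §1; [BergeronMillsonMoeglin2016Balls] Part 2 §§1.1, 3.1.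
-/

set_option autoImplicit false

noncomputable section

namespace Summit.HodgeConjecture.CorCM.Lines.A3Liu418

open CategoryTheory CategoryTheory.Limits AlgebraicGeometry NumberField Function MulAction
open scoped TensorProduct Matrix ComplexOrder
open Literature.AlgebraicGeometry.Motives
open Literature.AlgebraicGeometry.ShimuraVarieties Literature.AlgebraicGeometry.ShimuraVarieties.UnitaryCanonicalModel
open Literature.NumberTheory.Automorphic Literature.NumberTheory.Automorphic.UnitaryGroup
open Literature.NumberTheory.Automorphic.Liu2021 Literature.NumberTheory.Automorphic.Liu2021.AppendixC
open Literature.NumberTheory.Automorphic.ShimuraDissection (CosetSpace)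
open Literature.Geometry.ComplexHyperbolic Literature.Geometry.ComplexHyperbolic.BallModel
open Literature.AlgebraicGeometry.HodgeTheory (complexBetti)
open Literature.AlgebraicTopology.SingularHomology (singularCohomology)
open Summit.HodgeConjecture.CorCM.Model Summit.HodgeConjecture.CorCM.Model.HComp Summit.HodgeConjecture.CorCM.HComp
open Summit.HodgeConjecture.CorCM.D2Bridge (albaneseH1Cmp sec42Data_injective_albaneseH1Cmp_of_n_eq_two)

/-! ## §0  The antecedents of the GS-3 fact at the face (after B-typ03's junction `SCRATCH-GS3-ClusterSig.v3` §1, by name over ★ G9 / ★ G5) -/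

section GSFace

variable {F : CMField} {ι₁ : F →+* ℂ} (V : HermSpace3 F ι₁) (h4 : 4 ≤ Module.finrank ℚ F)
  (Jstar : Matrix (Fin 2) (Fin 2) F) (Jperp : Matrix (Fin 1) (Fin 1) F) (B : GL (Fin 3) F)
  (hB : formCongr ((IsCMField.complexConj F : F ≃ₐ[↥(maximalRealSubfield F)] F) : F →+* F) B ((1 : F) • V.Hm) =
    finSum 2 1 Jstar Jperp)
  (hpos : ∀ τ : F →+* ℂ, 0 < (τ (Jperp 0 0)).re)
  (K₁ : C5.OpenCompactSubgroup ↥(finAdelic (↥(maximalRealSubfield F)) F (IsCMField.complexConj F) 2 Jstar))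

/-- `HermSpace3.isHermitian` in the matrix form `ᵗ(c̄ Hm) = Hm` that the (G9) sub-form lemmas consume. [cite: Liu2021, §C.1 (FJcycle.tex l. 4597–4599)] -/
theorem gsFace_transpose_map_Hm : (V.Hm.map (cmConjRingHom F))ᵀ = V.Hm := by
  ext i j
  rw [Matrix.transpose_apply, Matrix.map_apply]
  exact V.isHermitian j i

include hB in
/-- The pin's frame equation in the `cmConjRingHom` spelling. [cite: Liu2021, Thm. 4.15 proof l. 2193] -/
theorem gsFace_hB_cm : formCongr (cmConjRingHom F) B ((1 : F) • V.Hm) = finSum 2 1 Jstar Jperp := by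
  rw [← coe_complexConj_eq_conjRingHomK' F]; exact hB

include hB hpos in
/-- GS-3 antecedent: a signature-`(1,1)` frame of `J⋆^{ι₁}` — (G9) ★ `exists_frame_map_subform_left_eq_diagonal_one` from ★ `formCongr_frameOf V`, the pin
`hB` and `hpos ι₁`. [cite: Kudla1984, §1] [cite: BergeronMillsonMoeglin2016Balls, Part 2 §§1.1 and 3.1] -/
theorem gsFace_frame : ∃ Tstar : GL (Fin 2) ℂ, formCongr (starRingEnd ℂ) Tstar (Jstar.map ι₁) = Matrix.diagonal ![1, -1] :=
  exists_frame_map_subform_left_eq_diagonal_one (cmConjRingHom F) ι₁ (IsCMField.complexConj_apply_apply (K := F))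
    (embedding_cmConjRingHom F ι₁) (gsFace_transpose_map_Hm V) (formCongr_frameOf V) (gsFace_hB_cm V Jstar Jperp B hB) (hpos ι₁)

include hB in
/-- GS-3 antecedent: `J⋆` is definite off the place of `ι₁` — (G9) ★ `posDef_map_subform_left` + `isHermitian_subform_left` from ★ `V.posDef_of_ne`.
[cite: Kudla1984, §1] [cite: BergeronMillsonMoeglin2016Balls, Part 2 §§1.1 and 3.1] -/
theorem gsFace_posDef : ∀ τ' : F →+* ℂ, InfinitePlace.mk τ' ≠ InfinitePlace.mk ι₁ → (Jstar.map τ').PosDef := fun τ' hτ' =>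
  posDef_map_subform_left (N₁ := 2) (N₂ := 1) (cmConjRingHom F) τ' (embedding_cmConjRingHom F τ') (V.posDef_of_ne τ' hτ')
    (by rw [map_one, Complex.one_re]; exact one_pos) (by rw [map_one, Complex.one_im])
    (isHermitian_subform_left (N₁ := 2) (N₂ := 1) (cmConjRingHom F) (IsCMField.complexConj_apply_apply (K := F))
      (gsFace_transpose_map_Hm V) (map_one _) (gsFace_hB_cm V Jstar Jperp B hB))
    (gsFace_hB_cm V Jstar Jperp B hB)

include h4 hB in
/-- GS-3 antecedent: `J⋆` is anisotropic over `F` — (G9) ★ `anisotropic_subform_left` from ★ `HermSpace3.anisotropic_of_four_le` (`4 ≤ [F:ℚ]`).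
[cite: Kudla1984, §1] [cite: Liu2021, §4.2 l. 2053–2060] -/
theorem gsFace_anisotropic : ∀ v : Fin 2 → F, Literature.AlgebraicGeometry.ShimuraVarieties.hermForm (cmConjRingHom F) Jstar v v = 0 → v = 0 :=
  anisotropic_subform_left (N₁ := 2) (N₂ := 1) (cmConjRingHom F) (V.anisotropic_of_four_le h4) one_ne_zero (gsFace_hB_cm V Jstar Jperp B hB)

/-- The source threshold `K₀⋆ := K₁ ∩ φGS⁻¹(K_f(3))` maps into `K_f(3)` — (G5) ★ `OpenCompactSubgroup.map_restrict_le`; the `hK₀` field of the seesaw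
source at the face. [cite: Liu2021, Prop. C.5 (FJcycle.tex l. 4627–4628) and Thm. 4.15 proof l. 2199] -/
theorem gsFace_hK₀ :
    (C5.OpenCompactSubgroup.restrict (φGS F Jstar Jperp V.Hm B one_ne_zero hB) (continuous_φGS F Jstar Jperp V.Hm B one_ne_zero hB)
        K₁ (K3 V)).1.map (φGS F Jstar Jperp V.Hm B one_ne_zero hB) ≤ (K3 V).1 :=
  C5.OpenCompactSubgroup.map_restrict_le _ _ K₁ (K3 V)

/-- GS-3 antecedent: all conjugate arithmetic levels of `K₀⋆` are torsion-free — (G5) ★ `torsionFree_arithmeticLevel_conj_frameEmb` from the rank-3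
threshold's ★ `torsionFree_arithmeticLevel_conj_K3 V`. [cite: Liu2021, §C.1 l. 4599 («neat») and Prop. C.5 l. 4627–4628] -/
theorem gsFace_neat :
    ∀ g : finAdelic (↥(maximalRealSubfield F)) F (IsCMField.complexConj F) 2 Jstar,
      ∀ γ ∈ arithmeticLevel (↥(maximalRealSubfield F)) F (IsCMField.complexConj F) 2 Jstar
        ((C5.OpenCompactSubgroup.restrict (φGS F Jstar Jperp V.Hm B one_ne_zero hB) (continuous_φGS F Jstar Jperp V.Hm B one_ne_zero hB)
          K₁ (K3 V)).1.map (MulAut.conj g).toMonoidHom), IsOfFinOrder γ → γ = 1 :=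
  torsionFree_arithmeticLevel_conj_frameEmb (↥(maximalRealSubfield F)) F (IsCMField.complexConj F) 2 1 Jstar Jperp V.Hm B
    one_ne_zero hB (gsFace_hK₀ V Jstar Jperp B hB K₁) (torsionFree_arithmeticLevel_conj_K3 V)

/-- `0 < Re ι₁(1)` (the pin's `hτa` at `a = 1`). [cite: Liu2021, Thm. 4.15 proof l. 2193] -/
theorem gsFace_re_map_one_pos : 0 < (ι₁ (1 : F)).re := by rw [map_one, Complex.one_re]; exact one_pos

/-- `Im ι₁(1) = 0` (the pin's `hτa′` at `a = 1`). [cite: Liu2021, Thm. 4.15 proof l. 2193] -/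
theorem gsFace_im_map_one : (ι₁ (1 : F)).im = 0 := by rw [map_one, Complex.one_im]

include h4 hpos in
/-- **The GS-3 fact AT THE FACE**: from `exists_recordSystemGS` ([Deligne1979ShimuraVarieties] Thm. 2.7.20 / Cor. 2.7.21 for the compact unitary Shimura
curve; [Milne2005ShimuraVarieties] Thm. 13.6, 13.7), with its antecedents fed by `gsFace_frame` / `_posDef` / `_anisotropic` / `_neat`: a curve record system
`S` on `K₀⋆ = K₁ ∩ φGS⁻¹(K_f(3))` with Hecke translates and the embedding into THE chosen rank-3 record `recordOf h V h4` defined over `F`, and the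
level-quotient property — the binders `(S) (hU7ₛ) (hEmb) (hLQ)` of `seesawSourceGS` at `a = 1`.
[cite: Deligne1979ShimuraVarieties, Thm. 2.7.20 (a), Cor. 2.7.21, 2.2.5–2.2.6] [cite: Milne2005ShimuraVarieties, Thm. 13.6 p. 118, Thm. 13.7 and Rem. 13.8 p. 119] -/
theorem gsFace_cluster (hGS3 : exists_recordSystemGS) (h : exists_recordSystem) :
    ∃ S : RecordSystemGS F Jstar ι₁
        (C5.OpenCompactSubgroup.restrict (φGS F Jstar Jperp V.Hm B one_ne_zero hB) (continuous_φGS F Jstar Jperp V.Hm B one_ne_zero hB) K₁ (K3 V)),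
      S.HeckeTranslateDefinedOver ∧ S.IsLevelQuotient ∧
        S.EmbeddingDefinedOver (recordOf h V h4) Jperp B one_ne_zero hB gsFace_re_map_one_pos gsFace_im_map_one := by
  obtain ⟨Tstar, hTstar⟩ := gsFace_frame V Jstar Jperp B hB hpos
  obtain ⟨S, hU7ₛ, hLQ, hEmb⟩ := hGS3 F Jstar ι₁ Tstar hTstar (gsFace_posDef V Jstar Jperp B hB) (gsFace_anisotropic V h4 Jstar Jperp B hB)
    _ (gsFace_neat V Jstar Jperp B hB K₁)
  exact ⟨S, hU7ₛ, hLQ, hEmb V.Hm (frameOf V) (formCongr_frameOf V) (K3 V) (recordOf h V h4) Jperp B 1 one_ne_zero hB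
    gsFace_re_map_one_pos gsFace_im_map_one⟩

end GSFace

/-! ## §1  The source-side bridge square for `towerHomGS` -/

section SourceBridge

variable {F : CMField} {ι₁ : F →+* ℂ} {Jstar : Matrix (Fin 2) (Fin 2) F}
  {K₀ : C5.OpenCompactSubgroup ↥(finAdelic (↥(maximalRealSubfield F)) F (IsCMField.complexConj F) 2 Jstar)}
  (S : RecordSystemGS F Jstar ι₁ K₀)
  (h : exists_recordSystem) (hU7 : heckeTranslate_definedOver) (V : HermSpace3 F ι₁) (Φ : CMType F)
  (h4 : 4 ≤ Module.finrank ℚ F) (isoₛ iso : ℕ → Prop)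
  (Jperp : Matrix (Fin 1) (Fin 1) F) (B : GL (Fin 3) F) {a : F} (ha : a ≠ 0)
  (hB : formCongr ((IsCMField.complexConj F : F ≃ₐ[↥(maximalRealSubfield F)] F) : F →+* F) B (a • V.Hm) = finSum 2 1 Jstar Jperp)
  (hτa : 0 < (ι₁ a).re) (hτa' : (ι₁ a).im = 0)
  (hU7ₛ : S.HeckeTranslateDefinedOver) (hEmb : S.EmbeddingDefinedOver (recordOf h V h4) Jperp B ha hB hτa hτa')

/-- **The source-side bridge square.**  For the tower morphism `towerHomGS` (its level map in the `rfl`-unfolded form ★ `towerHomGS_map`: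
`(ι_{K⋆,K} ≫ recordFunctorOf_objIso⁻¹) ⊗_c F`) the bridges `Eₛ : (X⋆_{K⋆})_{τ′} ≅ (M⋆_{K⋆})_{ι₁}` (transitivity of base change along
`(conj ∘ ι₁) ∘ c = ι₁`) and `E_K : (X_K)_{τ′} ≅ (M_K)_{ι₁}` (F3 §1b) intertwine it with the record-level embedding `ι_{K⋆,K}`:
`(map)_{τ′} ≫ E_K = Eₛ ≫ (ι_{K⋆,K})_{ι₁}` — ★ `baseChangeHomObjIsoOfComp_comm`. [cite: GortzWedhorn2020, Prop. 4.16 and §(4.7)]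
[cite: Milne2005ShimuraVarieties, Thm. 13.6 p. 118] -/
theorem baseChange_recordEmbedding_comp_bridge_hom (Kstar : C5.SmallLevel K₀) (K : C5.SmallLevel (K3 V))
    (hK : Kstar.1.1.map (φGS F Jstar Jperp V.Hm B ha hB) ≤ K.1.1) :
    (baseChangeHom ((starRingEnd ℂ).comp ι₁)).map ((baseChangeHom (cmConjRingHom F)).map
        (recordEmbedding S h V h4 Jperp B ha hB hτa hτa' hEmb Kstar K hK ≫ (recordFunctorOf_objIso h V h4 K).inv)) ≫
        (baseChangeHomObjIsoOfComp (cmConjRingHom F) ((starRingEnd ℂ).comp ι₁) ι₁ (conj_comp_comp_cmConjRingHom ι₁)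
            ((recordFunctorOf h V).obj K) ≪≫
          (baseChangeHom ι₁).mapIso (recordFunctorOf_objIso h V h4 K)).hom =
      (baseChangeHomObjIsoOfComp (cmConjRingHom F) ((starRingEnd ℂ).comp ι₁) ι₁ (conj_comp_comp_cmConjRingHom ι₁) (S.M.obj Kstar)).hom ≫
        (baseChangeHom ι₁).map (recordEmbedding S h V h4 Jperp B ha hB hτa hτa' hEmb Kstar K hK) := by
  rw [Iso.trans_hom, Functor.mapIso_hom, Literature.AlgebraicGeometry.Motives.baseChangeHomObjIsoOfComp_comm_assoc, ← Functor.map_comp,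
    Category.assoc, Iso.inv_hom_id, Category.comp_id]

end SourceBridge

/-! ## §2a  The GS source's tower morphism DETECTS a class cut out on the target's identity piece (record-typed level) -/

section Detect

variable {F : CMField} {ι₁ : F →+* ℂ} {Jstar : Matrix (Fin 2) (Fin 2) F}
  {K₀ : C5.OpenCompactSubgroup ↥(finAdelic (↥(maximalRealSubfield F)) F (IsCMField.complexConj F) 2 Jstar)}
  (S : RecordSystemGS F Jstar ι₁ K₀)
  (h : exists_recordSystem) (hU7 : heckeTranslate_definedOver) (V : HermSpace3 F ι₁) (Φ : CMType F)
  (h4 : 4 ≤ Module.finrank ℚ F) (isoₛ iso : ℕ → Prop)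
  (Jperp : Matrix (Fin 1) (Fin 1) F) (B : GL (Fin 3) F) {a : F} (ha : a ≠ 0)
  (hB : formCongr ((IsCMField.complexConj F : F ≃ₐ[↥(maximalRealSubfield F)] F) : F →+* F) B (a • V.Hm) = finSum 2 1 Jstar Jperp)
  (hτa : 0 < (ι₁ a).re) (hτa' : (ι₁ a).im = 0)
  (hU7ₛ : S.HeckeTranslateDefinedOver) (hEmb : S.EmbeddingDefinedOver (recordOf h V h4) Jperp B ha hB hτa hτa')

set_option maxHeartbeats 4000000 in
/-- **The GS tower morphism detects, at level `Λ`, every class of `(X_Λ)_{τ′}` cut out NON-TRIVIALLY on the target's identity piece by the four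
`F`-clauses.**  Given a pieces leg `ι q₁ : X₁ ⟶ (M_Λ)_{ι₁}` of a colimit cofan with ball datum `Bq` through a representative `gq` with
`gq⁻¹ γ₁ ∈ Λ` (`γ₁ ∈ U(V)(F⁺)`), a frame `B₀ = γ₁ B`, a class `x ∈ H¹((X_Λ)_{τ′}(ℂ); ℂ)` whose restriction `c₁` to `X₁` (along the bridge `E_Λ`)
is detected by every special curve satisfying the four clauses at `(V.Hm, ι₁, Γ_V(gq Λ gq⁻¹), F ∙ B₀ e₃)` — the `hdet` shape of ★ (7-src) — then
`(towerHomGS … ).map Λ` pulls `x` back non-trivially: the source's identity piece (★ `RecordSystemGS.pieces` at `K⋆ := φ⁻¹Λ ∩ K₀⋆`, its rational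
representative by ★ `exists_rep_inv_mul_rational_mem`) factors through `X₁` and detects `c₁` (★ `exists_fac_pullback_ne_zero_of_rational_reps`), and
the square of bridges (§1) turns this into `(towerHomGS.map Λ)_{τ′}^* x ≠ 0` (★ `complexBetti_map_ne_zero_of_square`).
[cite: Liu2021, Thm. 4.15 proof p. 51 (FJcycle.tex l. 2199–2213) with fn. 9] [cite: Milne2005ShimuraVarieties, Thm. 13.6 p. 118; Lemma 5.13 p. 57]
[cite: GortzWedhorn2020, Prop. 4.16] -/
theorem schemeBettiPullAlong_towerHomGS_map_ne_zero (Λ : C5.SmallLevel (K3 V))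
    {Ξ : Type} {Xp : Ξ → SchemeOver ℂ} {ι : ∀ q, Xp q ⟶ (baseChangeHom ι₁).obj ((recordOf h V h4).M.obj Λ)}
    (hcol : IsColimit (Cofan.mk ((baseChangeHom ι₁).obj ((recordOf h V h4).M.obj Λ)) ι))
    (q₁ : Ξ) (Bq : UnitaryBallUniformisationDatum 2 (Xp q₁)) (gq : ↥V.adelicFin) (hBq : Bq.Hℂ = V.Hm.map ι₁)
    (hιq : letI : Algebra F ℂ := ι₁.toAlgebra
      ∀ x : Ball, AlgPoints.map (L := ℂ) (ι q₁) (Bq.unif ((frameOf V : Matrix (Fin 3) (Fin 3) ℂ) *ᵥ BallModel.lift x)) =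
        AlgPoints.baseChangeEquiv ι₁ ((recordOf h V h4).M.obj Λ)
          (((recordOf h V h4).pts Λ).symm (ShimuraSet.mk F V.Hm ι₁ (frameOf V) (formCongr_frameOf V) Λ.1.1 x gq)))
    (γ₁ : ↥(rational (↥(maximalRealSubfield F)) F (IsCMField.complexConj F) 3 V.Hm))
    (hγ₁ : gq⁻¹ * rationalToFinAdelic (↥(maximalRealSubfield F)) F (IsCMField.complexConj F) 3 V.Hm γ₁ ∈ Λ.1.1)
    (B₀ : GL (Fin 3) F) (hBB₀ : (γ₁ : GL (Fin 3) F) * B = B₀) (c₁ : complexBetti (Xp q₁) 1)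
    (hdet : ∀ (Y' : SchemeOver ℂ) (D' : UnitaryBallUniformisationDatum 1 Y') (φ' : Y' ⟶ Xp q₁) (M : Matrix (Fin 3) (Fin 2) ℂ),
      M.conjTranspose * V.Hm.map ι₁ * M = D'.Hℂ →
      (∀ v ∈ (F ∙ fun i => ((B₀ : GL (Fin 3) F) : Matrix (Fin 3) (Fin 3) F) i (Fin.last 2)), ∀ u : Fin 2 → ℂ,
        Literature.AlgebraicGeometry.ShimuraVarieties.hermForm (starRingEnd ℂ) (V.Hm.map ι₁) (⇑ι₁ ∘ v) (M.mulVec u) = 0) →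
      (∀ γ' ∈ D'.Γ, ∃ γ'' ∈ arithmeticLevel (↥(maximalRealSubfield F)) F (IsCMField.complexConj F) 3 V.Hm
          (Λ.1.1.map (MulAut.conj gq).toMonoidHom),
        (γ'' : Matrix (Fin 3) (Fin 3) F).map ι₁ * M = M * ((γ' : Matrix (Fin 2) (Fin 2) ↥D'.E)).map D'.E.subtype) →
      (∀ v ∈ negCone D'.Hℂ, AlgPoints.map (L := ℂ) φ' (D'.unif v) = Bq.unif (M.mulVec v)) →
        singularCohomology.map ℂ ℂ (AlgPoints.mapContinuous (L := ℂ) φ') 1 c₁ ≠ 0)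
    (x : schemeBettiH1Along ((sec42DataOfFourLe h V Φ h4 iso).X Λ) ((starRingEnd ℂ).comp ι₁))
    (hc₁ : c₁ = (complexBetti.map (ι q₁) 1).hom ((complexBetti.map
        (letI : Algebra F ℂ := Literature.NumberTheory.Automorphic.Liu2021.AppendixC.algebraAlong F ((starRingEnd ℂ).comp ι₁)
         (baseChangeHomObjIsoOfComp (cmConjRingHom F) ((starRingEnd ℂ).comp ι₁) ι₁ (conj_comp_comp_cmConjRingHom ι₁)
              ((recordFunctorOf h V).obj Λ) ≪≫ (baseChangeHom ι₁).mapIso (recordFunctorOf_objIso h V h4 Λ) :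
            (Literature.AlgebraicGeometry.Motives.baseChange F ℂ).obj ((sec42DataOfFourLe h V Φ h4 iso).X Λ) ≅
              (baseChangeHom ι₁).obj ((recordOf h V h4).M.obj Λ))).inv 1).hom x)) :
    schemeBettiPullAlong ((starRingEnd ℂ).comp ι₁)
      ((towerHomGS S h hU7 V Φ h4 isoₛ iso Jperp B ha hB hτa hτa' hU7ₛ hEmb).map Λ) x ≠ 0 := by
  letI inst : Algebra F ℂ := Literature.NumberTheory.Automorphic.Liu2021.AppendixC.algebraAlong F ((starRingEnd ℂ).comp ι₁)
  -- the source level `K⋆ := φGS⁻¹Λ ∩ K₀⋆` and its admissibility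
  have hKΛ : (C5.pullbackLevel (φGS F Jstar Jperp V.Hm B ha hB) (continuous_φGS F Jstar Jperp V.Hm B ha hB)
      (sec42DataGS S h4 isoₛ).S.K₀ Λ).1.1.map (φGS F Jstar Jperp V.Hm B ha hB) ≤ Λ.1.1 :=
    C5.map_pullbackLevel_le _ _ Λ
  -- the source's pieces at `K⋆`, its identity class and rational representative
  obtain ⟨gs, hgs, Ys, ιs, hcols, D, hD⟩ := S.pieces
    (C5.pullbackLevel (φGS F Jstar Jperp V.Hm B ha hB) (continuous_φGS F Jstar Jperp V.Hm B ha hB) (sec42DataGS S h4 isoₛ).S.K₀ Λ)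
  obtain ⟨γs, hγs⟩ := exists_rep_inv_mul_rational_mem hgs
  -- (7-src): the source's identity piece factors through `X₁` and detects `c₁`
  obtain ⟨φ, hφ, hφc⟩ := exists_fac_pullback_ne_zero_of_rational_reps S (recordOf h V h4) Jperp B ha hB hτa hτa' hKΛ q₁ Bq gq
    (D _) (ιs _) (gs _) hcol (isEmbedding_recordEmbedding S h V h4 Jperp B ha hB hτa hτa' hEmb _ Λ hKΛ)
    hBq hιq (hD _).1 (hD _).2.1 (hD _).2.2 γ₁ hγ₁ γs hγs B₀ hBB₀ c₁ hdet
  -- the square of bridges turns it into the detection by `(towerHomGS.map Λ)_{τ′}`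
  rw [schemeBettiPullAlong_def, towerHomGS_map]
  refine Literature.AlgebraicGeometry.Morphisms.complexBetti_map_ne_zero_of_square _
    (baseChangeHomObjIsoOfComp (cmConjRingHom F) ((starRingEnd ℂ).comp ι₁) ι₁ (conj_comp_comp_cmConjRingHom ι₁)
          ((recordFunctorOf h V).obj Λ) ≪≫ (baseChangeHom ι₁).mapIso (recordFunctorOf_objIso h V h4 Λ) :
        (Literature.AlgebraicGeometry.Motives.baseChange F ℂ).obj ((sec42DataOfFourLe h V Φ h4 iso).X Λ) ≅
          (baseChangeHom ι₁).obj ((recordOf h V h4).M.obj Λ))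
    (baseChangeHomObjIsoOfComp (cmConjRingHom F) ((starRingEnd ℂ).comp ι₁) ι₁ (conj_comp_comp_cmConjRingHom ι₁) (S.M.obj _))
    _ (baseChange_recordEmbedding_comp_bridge_hom S h V h4 Jperp B ha hB hτa hτa' hEmb _ Λ hKΛ) (ι q₁) (ιs _) φ hφ 1 x ?_
  rw [← hc₁]
  exact hφc

end Detect

/-! ## §2  CLAUSE (1) OF `S34SomeSource` FROM THE GS SOURCE, at the explicit carrier -/

section Main

variable {F : CMField} {ι₁ : F →+* ℂ}

set_option maxHeartbeats 8000000 in
/-- **CLAUSE (1) OF `S34SomeSource` FROM THE GS SEESAW SOURCE** ([Liu2021] proof of Thm. 4.15, p. 51 l. 2199–2213 with fn. 9: «one can find a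
decomposition `V = V⋆ ⊕ V⋆^⊥` … with `dim V⋆ = 2` such that the image of `c` under the restriction map … in `H¹_B(Sh(G⋆,h⋆), ℂ)` is nonzero»).
At `V`'s own §4.2 datum (explicit carrier `C₄`, translates `T₄`), given the named facts `hGS3` (canonical model of the compact unitary curve with
its translates / embedding / level quotients, [Deligne1979ShimuraVarieties] 2.7.20–21, [Milne2005ShimuraVarieties] 13.6–13.7), `hMR` (III-8′),
`hU7`, `h`, an induced étale Hecke datum `X`, a Betti pinning `B` along `conj ∘ ι₁` and a NON-ZERO `f` of the Hom-space: there are a `2 + 1` FRAME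
`(J⋆, J⊥, B)` of `V.Hm` (`J⊥` totally positive), a curve record system `S⋆` of `U(J⋆)` on the source threshold `K₀⋆` with `hU7ₛ`/`hEmb`/`hLQ`, such
that the SEESAW SOURCE `seesawSourceGS S⋆ …` (A-p17, GS-5b/8-core; `M := towerHomGS`) DETECTS `f`:
`((M.toEtaleTowerHom.etPull ℓ).baseChange ℚ_ℓ^{ac}).comp f ≠ 0`.  Proof = F3 `exists_identityPiece_detectingFrame_of_omegaHom_ne_zero` (target side)
→ E0 ★ `exists_rep_inv_mul_rational_mem` → frame `B := γ₁⁻¹ B₀` (★ `formCongr_mul_of_mem_rational`) → §0 `gsFace_cluster` → ★ `RecordSystemGS.pieces`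
at `K⋆ := φGS⁻¹Λ ∩ K₀⋆` → ★ (7-src) `exists_fac_pullback_ne_zero_of_rational_reps` → §1 + ★ `complexBetti_map_ne_zero_of_square` → F3 (ii) with
★ `hI_GS` and ★ `sec42Data_injective_albaneseH1Cmp_of_n_eq_two`.  `Pin` generic with its feeder `mkPin` (the registry's `FacePinData` constructor).
HC_CM is NOT proved; `hGS3`, `hMR`, `hU7`, `h` are hypotheses. [cite: Liu2021, Thm. 4.15 proof p. 51 (FJcycle.tex l. 2185–2213) with fn. 9]
[cite: MurtyRamakrishnan1992, Prop. 6 (through Liu2021 fn. 9)] [cite: Milne2005ShimuraVarieties, Thm. 13.6 p. 118; Lemma 5.13 p. 57]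
[cite: Deligne1979ShimuraVarieties, Thm. 2.7.20, Cor. 2.7.21, 2.1.2–2.1.4, 2.2.5–2.2.6] [cite: GortzWedhorn2020, Prop. 4.16] -/
theorem exists_seesawSourceGS_etPull_comp_ne_zero
    (hGS3 : exists_recordSystemGS)
    (hMR : ∀ {X' : SchemeOver ℂ} (D' : UnitaryBallUniformisationDatum 2 X'), D'.MR92Prop6Source)
    (hU7 : heckeTranslate_definedOver) (h : exists_recordSystem) (V : HermSpace3 F ι₁) (Φ : CMType F)
    (h4 : 4 ≤ Module.finrank ℚ F) (isoₛ iso : ℕ → Prop)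
    {ℓ : ℕ} [Fact ℓ.Prime] (X : (sec42DataOfFourLe h V Φ h4 iso).EtaleHeckeDatum ℓ) (ι' : ℂ ≃+* AlgebraicClosure ℚ_[ℓ])
    (hX : X.IsInducedBy (sec42DataOfFourLe_heckeTranslates hU7 h V Φ h4 iso))
    {H : Type} [AddCommGroup H] [Module ℂ H] {rhoB : Representation ℂ (sec42DataOfFourLe h V Φ h4 iso).G H}
    (Bpin : (sec42DataOfFourLe h V Φ h4 iso).BettiPinning (sec42DataOfFourLe_heckeTranslates hU7 h V Φ h4 iso)
      ((starRingEnd ℂ).comp ι₁) H rhoB)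
    {W : Type} [AddCommGroup W] [Module ℂ W] (ρW : Representation ℂ (sec42DataOfFourLe h V Φ h4 iso).G W)
    (f : W →ₛₗ[(ι' : ℂ →+* AlgebraicClosure ℚ_[ℓ])] AlgebraicClosure ℚ_[ℓ] ⊗[ℚ_[ℓ]] (sec42DataOfFourLe h V Φ h4 iso).etaleH1Tower ℓ)
    (hf : f ∈ X.omegaHom ι' ρW) (hf0 : f ≠ 0)
    (Pin : ∀ {P5ₛ : PropC5Data (↥(maximalRealSubfield F)) F} {isoₛ' : ℕ → Prop} (Cₛ : Sec42Data P5ₛ isoₛ'),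
      (Cₛ.G →* (sec42DataOfFourLe h V Φ h4 iso).G) → Prop)
    (mkPin : ∀ (Jstar : Matrix (Fin 2) (Fin 2) F) (Jperp : Matrix (Fin 1) (Fin 1) F) (B : GL (Fin 3) F)
      (hB : formCongr ((IsCMField.complexConj F : F ≃ₐ[↥(maximalRealSubfield F)] F) : F →+* F) B ((1 : F) • V.Hm) =
        finSum 2 1 Jstar Jperp) (_ : ∀ τ : F →+* ℂ, 0 < (τ (Jperp 0 0)).re)
      {K₀ : C5.OpenCompactSubgroup ↥(finAdelic (↥(maximalRealSubfield F)) F (IsCMField.complexConj F) 2 Jstar)}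
      (S : RecordSystemGS F Jstar ι₁ K₀), Pin (sec42DataGS S h4 isoₛ) (φGS F Jstar Jperp V.Hm B one_ne_zero hB)) :
    ∃ (Jstar : Matrix (Fin 2) (Fin 2) F) (Jperp : Matrix (Fin 1) (Fin 1) F) (B : GL (Fin 3) F)
      (hB : formCongr ((IsCMField.complexConj F : F ≃ₐ[↥(maximalRealSubfield F)] F) : F →+* F) B ((1 : F) • V.Hm) = finSum 2 1 Jstar Jperp)
      (hpos : ∀ τ : F →+* ℂ, 0 < (τ (Jperp 0 0)).re)
      (K₀ : C5.OpenCompactSubgroup ↥(finAdelic (↥(maximalRealSubfield F)) F (IsCMField.complexConj F) 2 Jstar))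
      (S : RecordSystemGS F Jstar ι₁ K₀) (hU7ₛ : S.HeckeTranslateDefinedOver)
      (hEmb : S.EmbeddingDefinedOver (recordOf h V h4) Jperp B one_ne_zero hB gsFace_re_map_one_pos gsFace_im_map_one)
      (hLQ : S.IsLevelQuotient)
      (hK₀ : ((sec42DataGS S h4 isoₛ).S.K₀.1 : Subgroup (sec42DataGS S h4 isoₛ).G).map (φGS F Jstar Jperp V.Hm B one_ne_zero hB) ≤
        (sec42DataOfFourLe h V Φ h4 iso).S.K₀.1),
      (((seesawSourceGS S h hU7 V Φ h4 isoₛ iso Jperp B one_ne_zero hB gsFace_re_map_one_pos gsFace_im_map_one hU7ₛ hEmb hLQ ℓ Pin hK₀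
          (mkPin Jstar Jperp B hB hpos S)).M.toEtaleTowerHom.etPull ℓ).baseChange (AlgebraicClosure ℚ_[ℓ])).comp f ≠ 0 := by
  letI inst : Algebra F ℂ := Literature.NumberTheory.Automorphic.Liu2021.AppendixC.algebraAlong F ((starRingEnd ℂ).comp ι₁)
  -- (0) THE TARGET SIDE (F3)
  obtain ⟨Λ, y', g, hg, Xp, ι, hcol, Bq, Jstar, Jperp, B₀, c₁, h7a, hB₀, hpos, hc₁, hdet, hspine⟩ :=
    exists_identityPiece_detectingFrame_of_omegaHom_ne_zero hMR hU7 h V Φ h4 iso X ι' hX Bpin ρW f hf hf0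
  -- (1) E0: the identity-class representative is rational up to the level; the embedding frame `B := γ₁⁻¹ B₀`
  obtain ⟨γ₁, hγ₁⟩ := exists_rep_inv_mul_rational_mem hg
  have hB₀' : formCongr ((IsCMField.complexConj F : F ≃ₐ[↥(maximalRealSubfield F)] F) : F →+* F) B₀ ((1 : F) • V.Hm) =
      finSum 2 1 Jstar Jperp := by
    rw [one_smul, coe_complexConj_eq_conjRingHomK' F]; exact hB₀
  have hB : formCongr ((IsCMField.complexConj F : F ≃ₐ[↥(maximalRealSubfield F)] F) : F →+* F)
      (((γ₁ : GL (Fin 3) F))⁻¹ * B₀) ((1 : F) • V.Hm) = finSum 2 1 Jstar Jperp := by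
    have e := formCongr_mul_of_mem_rational γ₁⁻¹ B₀ (1 : F)
    rw [Subgroup.coe_inv] at e
    exact e.trans hB₀'
  have hBB₀ : (γ₁ : GL (Fin 3) F) * (((γ₁ : GL (Fin 3) F))⁻¹ * B₀) = B₀ := mul_inv_cancel_left _ _
  -- (2) THE GS-3 FACT AT THE FACE: the curve record system of `U(J⋆)` on `K₀⋆ := K_f(3)⋆ ∩ φGS⁻¹(K_f(3))`
  let K₁ : C5.OpenCompactSubgroup ↥(finAdelic (↥(maximalRealSubfield F)) F (IsCMField.complexConj F) 2 Jstar) :=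
    ⟨finCongruenceLevel (↥(maximalRealSubfield F)) F (IsCMField.complexConj F) 2 Jstar (Ideal.span {(3 : 𝓞 F)}),
      isOpen_finCongruenceLevel (↥(maximalRealSubfield F)) F (IsCMField.complexConj F) 2 Jstar (Level.span_natCast_ne_zero le_rfl),
      isCompact_finCongruenceLevel (↥(maximalRealSubfield F)) F (IsCMField.complexConj F) 2 Jstar (Level.span_natCast_ne_zero le_rfl)⟩
  obtain ⟨Sstar, hU7ₛ, hLQ, hEmb⟩ := gsFace_cluster V h4 Jstar Jperp _ hB hpos K₁ hGS3 h
  have hK₀ := gsFace_hK₀ V Jstar Jperp (((γ₁ : GL (Fin 3) F))⁻¹ * B₀) hB K₁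
  refine ⟨Jstar, Jperp, _, hB, hpos, _, Sstar, hU7ₛ, hEmb, hLQ, hK₀, ?_⟩
  -- (3) the source detects `cmp_Λ y′` (§2a, record-typed level) and the spine's ∀-clause at `Λ` closes clause (1) for `M := towerHomGS`
  have hdetM := schemeBettiPullAlong_towerHomGS_map_ne_zero Sstar h hU7 V Φ h4 isoₛ iso Jperp (((γ₁ : GL (Fin 3) F))⁻¹ * B₀) one_ne_zero hB
    gsFace_re_map_one_pos gsFace_im_map_one hU7ₛ hEmb Λ hcol
    (Quotient.mk'' (CosetSpace.pt (rationalToFinAdelic _ F _ 3 V.Hm) Λ.1.1 1)) (Bq _) (g _) (h7a _).2.1 (h7a _).2.2.2 γ₁ hγ₁ B₀ hBB₀ c₁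
    hdet (albaneseH1Cmp ((sec42DataOfFourLe h V Φ h4 iso).X Λ) ((sec42DataOfFourLe h V Φ h4 iso).alb Λ) y') hc₁
  exact hspine (towerHomGS Sstar h hU7 V Φ h4 isoₛ iso Jperp _ one_ne_zero hB gsFace_re_map_one_pos gsFace_im_map_one hU7ₛ hEmb)
    (hI_GS Sstar h4 isoₛ ℓ) (sec42Data_injective_albaneseH1Cmp_of_n_eq_two (sec42DataGS Sstar h4 isoₛ) rfl _) hdetM

end Main

end Summit.HodgeConjecture.CorCM.Lines.A3Liu418

end
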